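import Mathlib
import Summits.ValiantsHypothesis.ValiantsHypothesis.Theorems.BorderApolarityBorelFixedBorderApolarityNonempty

/-!
# `DetqpThesis` (stmt-ValiantsHypothesis-0315), line `four-dimensional-determinant` — stub B1:
# sequential border apolarity (necessity half) for `Δ(det_m)` and an arbitrary target

Crux `DetQP.DetqpThesis` (stmt-ValiantsHypothesis-0315), line `four-dimensional-determinant`,
registered stub `stub_sequentialApolarity` (B1).

**What.** If `Q ∈ Δ(det_m) = \overline{GL_{m²} · det_m}` (Zariski orbit closure, `orbitClosure`)
then there are translates `P_t ∈ GL · det_m` and a family `J = (J_k)_k` of sets of forms which is,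
degree by degree for `k ≤ m`, the Kuratowski limit of the annihilator spaces `Ann_k(P_t)`
(`IsBorderApolarLimit m P J`), and every `D ∈ J_k` kills `Q` under the apolarity action
(`J_k ⊆ Ann_k(Q)`).  This is the necessity half of border apolarity (Buczyńska–Buczyński 2021,
Thm 1; Landsberg 2017, §10.1.2) for the orbit closure of the determinant, with an ARBITRARY target
`Q` (the route file `BorderApolarityBorelFixedBorderApolarityNonempty` proves the same statement,
`bfba_nonempty`, for the padded permanent; its proof uses the target only through "`Q` is a form
of degree `m`", which here follows from `Q ∈ Δ(det_m)`).

**How.**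
* `seqap_exists_seq_of_mem_orbitClosure` — `Q` is a form of degree `m`
  (`MvPolynomial.IsHomogeneous.of_mem_orbitClosure`: the forms of degree `m` are a Zariski closed
  set containing the orbit); Zariski closure = Euclidean closure of the orbit over `ℂ` in the
  degree-`m` coefficient space (`orbitClosure_eq_euclidean_closure_complex_holds`) and first
  countability give `P_t ∈ GL · det_m` with `P_t → Q` coefficientwise (coefficients off degree `m`
  vanish identically on both sides);
* `bfba_extract` (target-agnostic) — along a subsequence the annihilator planes `Ann_k(P_t)`
  Kuratowski-converge for every `k ≤ m`;
* `bfba_tendsto_apolarAction` — the apolarity pairing is jointly continuous on forms of fixed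
  degrees, so passing to the limit in `D_t ⌟ P_t = 0` gives `D ⌟ Q = 0`.

`m = 0` and `Q = 0` are allowed and harmless (no `NeZero m` is needed anywhere).

References: W. Buczyńska, J. Buczyński, *Apolarity, border rank, and multigraded Hilbert
scheme*, Duke Math. J. 170 (2021), Thm 1 (necessity half) [BuczynskaBuczynski2021];
J. M. Landsberg, *Geometry and Complexity Theory*, CUP 2017, §10.1.2 and Thm 3.1.6.1
[LandsbergGCT2017].
-/

noncomputable section

-- single-conjunct layout: Sub = Summit, duplicated namespace component intended
set_option linter.dupNamespace false

namespace Summit.ValiantsHypothesis.ValiantsHypothesis.Theorems.DetQPDetqpThesis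

open Literature.Computability.AlgebraicComplexity MvPolynomial Filter
open scoped Topology
open Summit.ValiantsHypothesis.ValiantsHypothesis.Theorems.BorderApolarityBorelFixedBorderApolarity

/-- `det_m` (in the `m²` variables `Fin m × Fin m`) is a form of degree `m`. [folklore] -/
theorem seqap_detPoly_isHomogeneous (m : ℕ) : (detPoly (Fin m) ℂ).IsHomogeneous m := by
  have h := detPoly_isHomogeneous (n := Fin m) (k := ℂ)
  rwa [Fintype.card_fin] at h

/-- Elements of `GL · det_m` are forms of degree `m`. [folklore] -/
theorem seqap_isHomogeneous_of_mem_glOrbit {m : ℕ} {P : MvPolynomial (Fin m × Fin m) ℂ}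
    (hP : P ∈ glOrbit (Fin m × Fin m) ℂ (detPoly (Fin m) ℂ)) : P.IsHomogeneous m := by
  have h := BorderApolarity.isHomogeneous_of_mem_glOrbit_detPoly hP
  rwa [Fintype.card_fin] at h

/-- Elements of `Δ(det_m)` are forms of degree `m` (the forms of degree `m` are a Zariski closed
set containing the orbit; Mulmuley–Sohoni 2001 §4). [folklore] -/
theorem seqap_isHomogeneous_of_mem_orbitClosure {m : ℕ} {Q : MvPolynomial (Fin m × Fin m) ℂ}
    (hQ : Q ∈ orbitClosure (detPoly (Fin m) ℂ)) : Q.IsHomogeneous m :=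
  (seqap_detPoly_isHomogeneous m).of_mem_orbitClosure hQ

/-- **Zariski limits of the orbit are sequential Euclidean limits.**  If `Q ∈ Δ(det_m)` then some
sequence `P_t ∈ GL · det_m` converges to `Q` coefficientwise (Zariski = Euclidean closure of an
orbit over `ℂ`, `orbitClosure_eq_euclidean_closure_complex_holds`, plus first countability of the
finite-dimensional degree-`m` coefficient space; off degree `m` all coefficients vanish).
[folklore] -/
theorem seqap_exists_seq_of_mem_orbitClosure {m : ℕ} {Q : MvPolynomial (Fin m × Fin m) ℂ}
    (hQ : Q ∈ orbitClosure (detPoly (Fin m) ℂ)) :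
    ∃ P₀ : ℕ → MvPolynomial (Fin m × Fin m) ℂ,
      (∀ t, P₀ t ∈ glOrbit (Fin m × Fin m) ℂ (detPoly (Fin m) ℂ)) ∧
      Tendsto (fun t => coeffVec (P₀ t)) atTop (𝓝 (coeffVec Q)) := by
  classical
  have hdet : (detPoly (Fin m) ℂ).IsHomogeneous m := seqap_detPoly_isHomogeneous m
  have hQhom : Q.IsHomogeneous m := seqap_isHomogeneous_of_mem_orbitClosure hQ
  haveI hfin : Fintype {d : (Fin m × Fin m) →₀ ℕ // d.degree = m} :=
    Fintype.subtype ((Finset.univ : Finset (Fin m × Fin m)).finsuppAntidiag m) fun d => by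
      simp [Finset.mem_finsuppAntidiag, Finsupp.degree_eq_sum]
  set ρ : MvPolynomial (Fin m × Fin m) ℂ → ({d : (Fin m × Fin m) →₀ ℕ // d.degree = m} → ℂ) :=
    fun g d => coeffVec g d.1 with hρ
  have h := orbitClosure_eq_euclidean_closure_complex_holds (σ := Fin m × Fin m) hdet
  have h1 : ρ Q ∈ closure (ρ '' glOrbit (Fin m × Fin m) ℂ (detPoly (Fin m) ℂ)) := by
    rw [← h]
    exact ⟨_, hQ, rfl⟩
  obtain ⟨x, hx, hxlim⟩ := mem_closure_iff_seq_limit.1 h1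
  choose P₀ hP₀ hP₀x using hx
  refine ⟨P₀, hP₀, ?_⟩
  rw [tendsto_pi_nhds]
  intro d
  by_cases hd : d.degree = m
  · have h2 := ((continuous_apply
      (⟨d, hd⟩ : {d : (Fin m × Fin m) →₀ ℕ // d.degree = m})).tendsto _).comp hxlim
    have h3 : ∀ t, x t ⟨d, hd⟩ = coeffVec (P₀ t) d := fun t => by rw [← hP₀x t]
    simp only [Function.comp_def, h3] at h2
    exact h2
  · have h2 : ∀ t, coeffVec (P₀ t) d = 0 := fun t =>
      (seqap_isHomogeneous_of_mem_glOrbit (hP₀ t)).coeff_eq_zero hd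
    have h3 : coeffVec Q d = 0 := hQhom.coeff_eq_zero hd
    simp only [h2, h3]
    exact tendsto_const_nhds

/-- **Stub B1 — sequential border apolarity for `Δ(det_m)`, necessity half, for an arbitrary
target.**  If `Q ∈ Δ(det_m) = \overline{GL_{m²}·det_m}` then there are translates
`P_t ∈ GL·det_m` and a family `J = (J_k)_k` which is, degree by degree for `k ≤ m`, the Kuratowski
limit of the annihilator spaces `Ann_k(P_t)` (`IsBorderApolarLimit m P J`), with `J_k ⊆ Ann_k(Q)`:
take `P_t → Q` (`seqap_exists_seq_of_mem_orbitClosure`), extract a subsequence along which all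
`Ann_k`, `k ≤ m`, converge (`bfba_extract`), and pass to the limit in `D_t ⌟ P_t = 0`
(`bfba_tendsto_apolarAction`).  Buczyńska–Buczyński 2021, Thm 1 (necessity), for the orbit
closure of `det_m`; Landsberg 2017, §10.1.2. [folklore] -/
theorem stub_sequentialApolarity {m : ℕ} (Q : MvPolynomial (Fin m × Fin m) ℂ)
    (hQ : Q ∈ orbitClosure (detPoly (Fin m) ℂ)) :
    ∃ (P : ℕ → MvPolynomial (Fin m × Fin m) ℂ) (J : ℕ → Set (MvPolynomial (Fin m × Fin m) ℂ)),
      (∀ t : ℕ, P t ∈ glOrbit (Fin m × Fin m) ℂ (detPoly (Fin m) ℂ)) ∧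
      IsBorderApolarLimit m P J ∧
      (∀ k ≤ m, ∀ D ∈ J k, apolarAction D Q = 0) := by
  obtain ⟨P₀, hP₀, hlim⟩ := seqap_exists_seq_of_mem_orbitClosure hQ
  obtain ⟨φ, hφ, J, hJ⟩ := bfba_extract P₀ hP₀ m
  refine ⟨fun t => P₀ (φ t), J, fun t => hP₀ (φ t), hJ, fun k hk D hD => ?_⟩
  obtain ⟨Ds, hDs, hDlim⟩ := hJ.exists_tendsto hk hD
  have hQhom : Q.IsHomogeneous m := seqap_isHomogeneous_of_mem_orbitClosure hQ
  have hPhom : ∀ t, (P₀ (φ t)).IsHomogeneous m := fun t =>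
    seqap_isHomogeneous_of_mem_glOrbit (hP₀ (φ t))
  have h := bfba_tendsto_apolarAction (fun t => (hDs t).1) (hJ.isHomogeneous_of_mem hk hD) hPhom
    hQhom hDlim (hlim.comp hφ.tendsto_atTop)
  have h0 : (fun t => coeffVec (apolarAction (Ds t) (P₀ (φ t)))) = fun _ => coeffVec 0 := by
    funext t
    rw [(hDs t).2]
  rw [h0] at h
  exact coeffVec_injective (tendsto_nhds_unique tendsto_const_nhds h).symm

end Summit.ValiantsHypothesis.ValiantsHypothesis.Theorems.DetQPDetqpThesis
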